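import Summits.QuantumFields.BalabanUV.Beta.D1BFx.ScaleLegRows

/-!
# `BalabanUV.Beta.D1BFx.TwoPointEnds` — road «BF-x» for binder row D1, «A3.c ∕ L-X TAILS» PART II (F1): END OPERATIONS on scalar two-point kernels
# `K : ℤ⁴ → ℤ⁴ → ℝ` — shifts `shL`∕`shR` and iterated unit differences `itL`∕`itR` of the first ∕ second argument, and their commutation

HONEST DEPENDENCY (page 1, mandatory): continuum YM on T⁴ ⇐ BetaPertH ∧ nine spine estimates (0/9 proved); BetaPertH ⇐ (D1) ∧ (D4) ∧
CAP+tail; G-an2-4 gates asym, D1 and NE2/3/4.  HONEST FRAMING (cell contract, verbatim): «discharging `BetaPertH` makes Bałaban's UV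
stability UNCONDITIONAL — a real constructive-QFT result; it is NOT the continuum limit and NOT the Clay problem.»  THIS MODULE DISCHARGES
NOTHING of the wall: four DATA definitions with bodies ([our objects] `shL`, `shR`, `itL`, `itR`) and [folklore] `funext`∕`ring` identities.  No `Prop`
minted, nothing cited, 0 sorry.  0 wall binders; NOT an A3.c row, NOT (K), NOT D1, NOT `BetaPertH`, NOT continuum, NOT Clay.

ABSOLUTE RULE (cell charter, verbatim): «No internally-minted statement may enter as a cited fact. Every hypothesis is either kernel-proved in
this package or a verbatim quotation of a PUBLISHED theorem with page reference. The manuscript(s) under audit are NOT citable for their own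
disputed steps — they are the thing under adjudication; programme-internal (2001/route/tribunal) claims are never citable.»

WHY (owner d1-p2-g9 K-LOCAL-ROWS v0.1 «A3.c = the per-word EXPANSION of `biBubbleTable (legPiece r) (legPiece r′) SbT SbT μ ν (b+w) b` into
vertex-differentiated leg monomials»; RULING ρ-g9-32 «PART II instantiates (D) with the FLAT window grades of `legPiece 1∕2`»).  The 8 L-BUB words have
legs `diagPart Ga − frozenLeg gfrz`, `offPart Ga` — neither translation invariant nor fibre diagonal — so part (A)'s one-variable unfolding does not
apply.  In `tr(A·V·B·W)` with `V` realised at `z` and `W` at `z'`, a located pair `(x_p, y_p, m_p) ∈ V` and `(x_q, y_q, m_q) ∈ W` contribute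
`Σ_{a f f₁ f₂} m_p f₁ f · m_q f₂ a · A (z'+y_q) (z+x_p) a f₁ · B (z+y_p) (z'+x_q) f f₂`: a ROW move of `V` moves `A`'s SECOND argument, a COLUMN
move of `V` moves `B`'s FIRST argument, a ROW move of `W` moves `B`'s SECOND argument, a COLUMN move of `W` moves `A`'s FIRST argument.  With
`z = b + w`, `z' = b` (the road's `baseKer … b w`) the `w`-dependence sits in `A`'s second and `B`'s first argument; the other two ends are STATIC.
This file is the scalar end calculus that (F2) `BiBubbleTable` ∕ (F3) `GradedBiBubbleTerms` push the vertex differences into.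
* §1 [our objects] `SKer`, `shL`, `shR`, `itL`, `itR`; [folklore] `itL_sub`, `itR_sub`, `itR_diffL`, `itR_shL`, `itR_shR`, `itR_diffR`, `itL_shL`, `itL_shR`,
  `itL_diffL`, `itL_diffR`.
* §2 [folklore] SLICE DICTIONARIES to an3's `iterD` on constant families: `itR_slice` (`itR as K x (x+u) = iterD as (u ↦ K x (x+u)) u`), `itL_slice`,
  `itL_itR_comm` (the two ends commute), `itL_eq_itR_transpose` (static steps are moving steps of the transpose).
Unit `b2b-balaban-beta-d1-formalise-leaf-03` (gen 12), D1 formalisation swarm; `LEAVES-BFx.md` row «A3.c ∕ L-X TAILS» PART II (F1).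
-/

noncomputable section

namespace Summit.QuantumFields.BalabanUV.Beta.D1BFx.TwoPointEnds

open Literature.MathematicalPhysics.QuantumFieldTheory.Balaban1983to89.Beta
open DyadicShell (Pt)
open GradedBubbles (iterD)
open ScaleLegRows (iterD_const_cons)

/-! ## §1 End operations on scalar two-point kernels -/

/-- [our object] Scalar two-point kernels on `ℤ⁴` (one fibre entry of an `MKer`). -/
abbrev SKer : Type := Pt → Pt → ℝ

/-- [our object] Shift of the FIRST argument. -/
def shL (e : Pt) (K : SKer) : SKer := fun x y => K (x + e) y

/-- [our object] Shift of the SECOND argument. -/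
def shR (e : Pt) (K : SKer) : SKer := fun x y => K x (y + e)

/-- [our object] Iterated unit differences of the FIRST argument. -/
def itL : List Pt → SKer → SKer
  | [], K => K
  | e :: es, K => itL es (fun x y => K (x + e) y - K x y)

/-- [our object] Iterated unit differences of the SECOND argument. -/
def itR : List Pt → SKer → SKer
  | [], K => K
  | e :: es, K => itR es (fun x y => K x (y + e) - K x y)

/-- [folklore] `itL` is additive. -/
theorem itL_sub (es : List Pt) (K K' : SKer) : itL es (fun x y => K x y - K' x y) = fun x y => itL es K x y - itL es K' x y := by
  induction es generalizing K K' with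
  | nil => rfl
  | cons e es ih =>
      show itL es _ = fun x y => itL es _ x y - itL es _ x y
      rw [← ih]
      congr 1
      funext x y
      ring

/-- [folklore] `itR` is additive. -/
theorem itR_sub (es : List Pt) (K K' : SKer) : itR es (fun x y => K x y - K' x y) = fun x y => itR es K x y - itR es K' x y := by
  induction es generalizing K K' with
  | nil => rfl
  | cons e es ih =>
      show itR es _ = fun x y => itR es _ x y - itR es _ x y
      rw [← ih]
      congr 1
      funext x y
      ring

/-- [folklore] A left difference of an `itR` is the `itR` of the left difference (the two ends commute). -/
theorem itR_diffL (es : List Pt) (e : Pt) (K : SKer) :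
    (fun x y => itR es K (x + e) y - itR es K x y) = itR es (fun x y => K (x + e) y - K x y) := by
  induction es generalizing K with
  | nil => rfl
  | cons e' es ih =>
      show (fun x y => itR es _ (x + e) y - itR es _ x y) = itR es _
      rw [ih]
      congr 1
      funext x y
      ring

/-- [folklore] A left shift of an `itR` is the `itR` of the left shift. -/
theorem itR_shL (es : List Pt) (e : Pt) (K : SKer) : (fun x y => itR es K (x + e) y) = itR es (shL e K) := by
  induction es generalizing K with
  | nil => rfl
  | cons e' es ih =>
      show (fun x y => itR es _ (x + e) y) = itR es _
      rw [ih]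
      rfl

/-- [folklore] A right shift of an `itR` is the `itR` of the right shift. -/
theorem itR_shR (es : List Pt) (e : Pt) (K : SKer) : (fun x y => itR es K x (y + e)) = itR es (shR e K) := by
  induction es generalizing K with
  | nil => rfl
  | cons e' es ih =>
      show (fun x y => itR es _ x (y + e)) = itR es _
      rw [ih]
      congr 1
      funext x y
      simp only [shR]
      rw [add_right_comm]

/-- [folklore] A right difference of an `itR` is the `itR` with the step prepended. -/
theorem itR_diffR (es : List Pt) (e : Pt) (K : SKer) : (fun x y => itR es K x (y + e) - itR es K x y) = itR (e :: es) K := by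
  induction es generalizing K with
  | nil => rfl
  | cons e' es ih =>
      show (fun x y => itR es _ x (y + e) - itR es _ x y) = itR es _
      rw [ih]
      show itR es _ = itR es _
      congr 1
      funext x y
      simp only []
      rw [add_right_comm y e e']
      ring

/-- [folklore] A left shift of an `itL` is the `itL` of the left shift. -/
theorem itL_shL (es : List Pt) (e : Pt) (K : SKer) : (fun x y => itL es K (x + e) y) = itL es (shL e K) := by
  induction es generalizing K with
  | nil => rfl
  | cons e' es ih =>
      show (fun x y => itL es _ (x + e) y) = itL es _
      rw [ih]
      congr 1
      funext x y
      simp only [shL]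
      rw [add_right_comm]

/-- [folklore] A right shift of an `itL` is the `itL` of the right shift. -/
theorem itL_shR (es : List Pt) (e : Pt) (K : SKer) : (fun x y => itL es K x (y + e)) = itL es (shR e K) := by
  induction es generalizing K with
  | nil => rfl
  | cons e' es ih =>
      show (fun x y => itL es _ x (y + e)) = itL es _
      rw [ih]
      rfl

/-- [folklore] A left difference of an `itL` is the `itL` with the step prepended. -/
theorem itL_diffL (es : List Pt) (e : Pt) (K : SKer) : (fun x y => itL es K (x + e) y - itL es K x y) = itL (e :: es) K := by
  induction es generalizing K with
  | nil => rfl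
  | cons e' es ih =>
      show (fun x y => itL es _ (x + e) y - itL es _ x y) = itL es _
      rw [ih]
      show itL es _ = itL es _
      congr 1
      funext x y
      simp only []
      rw [add_right_comm x e e']
      ring

/-- [folklore] A right difference of an `itL` is the `itL` of the right difference. -/
theorem itL_diffR (es : List Pt) (e : Pt) (K : SKer) :
    (fun x y => itL es K x (y + e) - itL es K x y) = itL es (fun x y => K x (y + e) - K x y) := by
  induction es generalizing K with
  | nil => rfl
  | cons e' es ih =>
      show (fun x y => itL es _ x (y + e) - itL es _ x y) = itL es _
      rw [ih]
      congr 1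
      funext x y
      ring

/-! ## §2 Slice dictionaries: end differences of a two-point kernel ↔ an3's `iterD` on one-variable slices -/

section Slices

/-- [folklore] **THE SECOND-ARGUMENT SLICE**: `itR as K x (x + u) = iterD as (u ↦ K x (x + u)) u`. -/
theorem itR_slice (as : List Pt) (K : SKer) (x u : Pt) : itR as K x (x + u) = iterD as (fun (_ : ℕ) (_ : ℕ) => fun u => K x (x + u)) 0 0 u := by
  induction as generalizing K u with
  | nil => rfl
  | cons e as ih =>
      show itR as (fun x y => K x (y + e) - K x y) x (x + u) = _
      rw [ih, iterD_const_cons]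
      congr 2
      funext _ _ v
      simp only [add_assoc]

/-- [folklore] **THE FIRST-ARGUMENT SLICE**: `itL as K (y + u) y = iterD as (u ↦ K (y + u) y) u`. -/
theorem itL_slice (as : List Pt) (K : SKer) (y u : Pt) : itL as K (y + u) y = iterD as (fun (_ : ℕ) (_ : ℕ) => fun u => K (y + u) y) 0 0 u := by
  induction as generalizing K u with
  | nil => rfl
  | cons e as ih =>
      show itL as (fun x y => K (x + e) y - K x y) (y + u) y = _
      rw [ih, iterD_const_cons]
      congr 2
      funext _ _ v
      simp only [add_assoc]

/-- [folklore] **THE TWO ENDS COMMUTE**: `itL sL (itR sR K) = itR sR (itL sL K)`. -/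
theorem itL_itR_comm (sL sR : List Pt) (K : SKer) : itL sL (itR sR K) = itR sR (itL sL K) := by
  induction sL generalizing K with
  | nil => rfl
  | cons e sL ih =>
      show itL sL (fun x y => itR sR K (x + e) y - itR sR K x y) = itR sR (itL sL (fun x y => K (x + e) y - K x y))
      rw [itR_diffL, ih]

/-- [folklore] **STATIC STEPS AS MOVING STEPS OF THE TRANSPOSE**: `itL as K x y = itR as (fun y x => K x y) y x`. -/
theorem itL_eq_itR_transpose (as : List Pt) (K : SKer) (x y : Pt) : itL as K x y = itR as (fun y x => K x y) y x := by
  induction as generalizing K with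
  | nil => rfl
  | cons e as ih =>
      show itL as (fun x y => K (x + e) y - K x y) x y = itR as (fun y' x' => (fun y x => K x y) y' (x' + e) - (fun y x => K x y) y' x') y x
      rw [ih]

end Slices

end Summit.QuantumFields.BalabanUV.Beta.D1BFx.TwoPointEnds

end
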